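import Summits.BirchSwinnertonDyer.BirchSwinnertonDyer.Theorems.SylvesterTwoHeegnerIndexYinPointOfToricDescent
import Summits.BirchSwinnertonDyer.BirchSwinnertonDyer.Theorems.SylvesterTwoHeegnerIndexYinToric
import Literature.NumberTheory.EllipticCurves.BSDQuadraticDescentTorsionOddPartProofs
import HarnessLib

/-!
# Route `SylvesterTwoHeegnerIndex` (rung K7t): the TRANSFER OF `2`-DIVISIBILITY between Yin's point and
# the anti-trace, and its TWIST LAYER — bsd-cm-two's §54.3 «transfer principle» as kernel algebra

HONEST FRAMING (cell b2b-bsdres, seat x1b GEN 54 = O12 class lead; file `--supports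
stmt-BirchSwinnertonDyer-19891 --as helper`; closes no item; nothing here is a mechanism, a definition or a
named fact; no label moves; BSD is not claimed). MEMO-bsd-cm-two v2.10/v2.11 §52 proves THEOREM C′
(`p ≡ 7 (9)`) from the TRACE RELATION (C2) `N·Z_p = −[ζ](R + cR)` (+ torsion; `N` odd, `c` = complex
conjugation of `K(i)/K`) and the VANISHING of the anti-trace `(1 − c)R` (coherent toric period); §54.3
observes that for `p ≡ 4 (9)` the relation (C2) still holds while `(1 − c)R` is a genuine Heegner point
`y_{χκ}` on the twist `E_p^{(−1)}`, and states the TRANSFER PRINCIPLE «`Z_p` is a `2`-adic generator of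
`E_p(K)` ⟺ `y_{χκ}` is a `2`-adic generator of `E_p^{(−1)}(K)`» (two g9: «a typed-statement candidate for
the LOWER side, not filed»). This file proves the ALGEBRA of that principle — and nothing else — in the
currency of two's binder `SylvesterTwoYinToric.TraceRelationAtTwo` and of the tree's quadratic-twist
dictionary (`QuadraticDescent.twistMap`):

* §1 bookkeeping for «`x ∈ 2M + M_tors`» (spelled `∃ S T, IsOfFinAddOrder T ∧ x = 2•S + T`, no definition):
  transport along additive maps / isomorphisms, `R + cR` versus `R − cR` (they differ by `2•R`), negation,
  torsion shifts, odd multiples;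
* §2 **THE TRANSFER AT THE BINDER LEVEL.** For ANY `B/ℚ`, fields `K ⊂ L` of characteristic `0`,
  `c : L ≃ₐ[K] L`, `θ` additive, `N • ι Y = −θ(R + cR) + T` (`TraceRelationAtTwo`), `T` torsion:
  (⟸) if `L/K` is finite Galois, `B(L)[2] = 0`, `N` odd and the anti-trace `R − cR` is `2`-DIVISIBLE MODULO
  TORSION in `B(L)`, then `Y ∈ 2B(K) + tors` (`exists_eq_two_smul_add_torsion_of_trace_of_antiTrace_twoDivisible`)
  — bsd-cm-two's p503775 / x1b [162] kernel theorem is the case «`R − cR` torsion»; (⟹) if `θ` is an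
  additive AUTOMORPHISM (the CM unit `[ζ]`, x1b [158] `exists_rootMulEquiv`) and `Y ∈ 2B(K) + tors`, then
  `R − cR ∈ 2B(L) + tors` — no hypothesis on `N` or on `L/K`; (⟺) and its contrapositive, the
  **PRIMITIVITY TRANSFER** `twoPrimitive_iff_antiTrace_twoPrimitive_of_traceRelation`. Valid for both residue
  classes `p ≡ 4, 7 (9)`; honest scope: ONE factor `2` (memo §54.4: no `2^j`-transfer exists for `j ≥ 2`);
* §3 **THE TWIST LAYER** (any field `F` with `2 ≠ 0`, `K = F(θ′)`, `θ′² = c`, completed-square model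
  `W¹ = W.quadraticTwist 1`, `σ` a non-trivial `F`-endomorphism of `K`): the `σ`-anti-fixed points of `W¹(K)`
  are the image of `τ : W^{(c)}(F) → W¹(K)` (tree `mem_range_twistMap_of_conjMap_eq_neg`), and when
  `W¹(K)[2] = 0`: «`τQ ∈ 2W¹(K) + tors ⟺ Q ∈ 2W^{(c)}(F) + tors`» (`twoDivisible_twistMap_iff`); hence for the
  anti-trace `R − σR = τQ`: «`R − σR ∈ 2W¹(K) + tors ⟺ Q ∈ 2W^{(c)}(F) + tors`».

NET (record for the planner; no ask): granted toric TRACE data of (C2)-shape for a display point `Y` over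
`L = K(i)` — for `p ≡ 4 (9)` this is memo Lemmas A–D verbatim (§54.3; cell/PRE, NOT typed here) —
«`Y` is `2`-primitive in `E_p(K)/tors`» (the 𝒱₀-LOWER residual in Yin currency, planner D163 (a)(4)) is
EQUIVALENT in the kernel to «the twist point of the anti-trace is `2`-primitive in `E_p^{(−1)}(K)/tors`».
The identification of that twist point with the sextic Heegner point `y_{χκ}` and everything about
`L′(E_p^{(−1)}, 1)` stay outside the kernel. NO definition, NO named fact, NO sorry; axioms standard.
References: MEMO-bsd-cm-two v2.11 (FROZEN 824312ee3aa75a62) §52.4 (C2), §54.3–54.4; pub/bsd-cm STATUS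
D163; Silverman AEC X.2 Prop. 2.4 / Exercise 10.16 (the twist dictionary), VIII.§1 (Galois descent).
-/

set_option autoImplicit false
-- the Summit-side namespace `Summit.BirchSwinnertonDyer.BirchSwinnertonDyer.…` (summit = problem) is mandated by D-0017
set_option linter.dupNamespace false

noncomputable section

open scoped Classical

open WeierstrassCurve WeierstrassCurve.Affine WeierstrassCurve.Affine.Point
open Summit.BirchSwinnertonDyer.BirchSwinnertonDyer.Theorems.SylvesterTwoYinOnePoint
  Summit.BirchSwinnertonDyer.BirchSwinnertonDyer.Theorems.SylvesterTwoYinToric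
  Summit.BirchSwinnertonDyer.BirchSwinnertonDyer.Theorems.SylvesterTwoYinToricDescent
  Literature.NumberTheory.EllipticCurves

namespace Summit.BirchSwinnertonDyer.BirchSwinnertonDyer.Theorems.SylvesterTwoYinToricTransfer

/-! ## §1 Bookkeeping for «`2`-divisible modulo torsion» -/

section Bookkeeping

variable {M M' : Type*} [AddCommGroup M] [AddCommGroup M']

/-- An additive map carries «`x = 2•S + T`, `T` torsion» to the same shape for `f x`. [folklore] -/
theorem exists_eq_two_smul_add_torsion_map (f : M →+ M') {x : M}
    (h : ∃ S T : M, IsOfFinAddOrder T ∧ x = (2 : ℤ) • S + T) :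
    ∃ S T : M', IsOfFinAddOrder T ∧ f x = (2 : ℤ) • S + T := by
  obtain ⟨S, T, hT, rfl⟩ := h
  exact ⟨f S, f T, f.isOfFinAddOrder hT, by rw [map_add, map_zsmul]⟩

/-- Along an additive ISOMORPHISM `e`, «`e x ∈ 2M′ + tors`» iff «`x ∈ 2M + tors`». [folklore] -/
theorem exists_eq_two_smul_add_torsion_iff_of_addEquiv (e : M ≃+ M') (x : M) :
    (∃ S T : M', IsOfFinAddOrder T ∧ e x = (2 : ℤ) • S + T) ↔
      ∃ S T : M, IsOfFinAddOrder T ∧ x = (2 : ℤ) • S + T := by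
  refine ⟨fun h => ?_, exists_eq_two_smul_add_torsion_map e.toAddMonoidHom⟩
  have h' := exists_eq_two_smul_add_torsion_map e.symm.toAddMonoidHom h
  simpa only [AddEquiv.toAddMonoidHom_eq_coe, AddMonoidHom.coe_coe, AddEquiv.symm_apply_apply] using h'

/-- «`−x ∈ 2M + tors`» iff «`x ∈ 2M + tors`». [folklore] -/
theorem exists_eq_two_smul_add_torsion_neg_iff (x : M) :
    (∃ S T : M, IsOfFinAddOrder T ∧ -x = (2 : ℤ) • S + T) ↔
      ∃ S T : M, IsOfFinAddOrder T ∧ x = (2 : ℤ) • S + T := by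
  constructor
  · rintro ⟨S, T, hT, h⟩
    exact ⟨-S, -T, hT.neg, by rw [smul_neg, ← neg_add, ← h, neg_neg]⟩
  · rintro ⟨S, T, hT, h⟩
    exact ⟨-S, -T, hT.neg, by rw [smul_neg, ← neg_add, ← h]⟩

/-- A torsion shift does not change «`2`-divisible modulo torsion». [folklore] -/
theorem exists_eq_two_smul_add_torsion_add_iff {T₀ : M} (hT₀ : IsOfFinAddOrder T₀) (x : M) :
    (∃ S T : M, IsOfFinAddOrder T ∧ x + T₀ = (2 : ℤ) • S + T) ↔
      ∃ S T : M, IsOfFinAddOrder T ∧ x = (2 : ℤ) • S + T := by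
  constructor
  · rintro ⟨S, T, hT, h⟩
    exact ⟨S, T + -T₀, hT.add hT₀.neg, by rw [← add_assoc, ← h, add_neg_cancel_right]⟩
  · rintro ⟨S, T, hT, h⟩
    exact ⟨S, T + T₀, hT.add hT₀, by rw [h, add_assoc]⟩

/-- An ODD multiple does not change «`2`-divisible modulo torsion» (`→`: x1b [160]
`exists_eq_two_smul_add_torsion_of_odd_smul`; `←`: `N•(2•S + T) = 2•(N•S) + N•T`). [folklore] -/
theorem exists_eq_two_smul_add_torsion_smul_iff_of_odd {N : ℤ} (hN : Odd N) (x : M) :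
    (∃ S T : M, IsOfFinAddOrder T ∧ N • x = (2 : ℤ) • S + T) ↔
      ∃ S T : M, IsOfFinAddOrder T ∧ x = (2 : ℤ) • S + T := by
  constructor
  · rintro ⟨S, T, hT, h⟩
    exact exists_eq_two_smul_add_torsion_of_odd_smul hN hT h
  · rintro ⟨S, T, hT, h⟩
    exact ⟨N • S, N • T, hT.zsmul, by rw [h, smul_add, smul_comm]⟩

/-- **`R + cR` versus `R − cR`.** For any additive `c` (complex conjugation on points), `R + cR` is
`2`-divisible modulo torsion iff `R − cR` is: they differ by `2•R`. This is the one-line heart of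
bsd-cm-two's transfer principle (MEMO v2.11 §54.3: «`(1+c)R ≡ −(1−c)R mod 2V`»). [folklore] -/
theorem exists_eq_two_smul_add_torsion_add_map_iff_sub_map (c : M →+ M) (R : M) :
    (∃ S T : M, IsOfFinAddOrder T ∧ R + c R = (2 : ℤ) • S + T) ↔
      ∃ S T : M, IsOfFinAddOrder T ∧ R - c R = (2 : ℤ) • S + T := by
  have key : ∀ X : M, (∃ S T : M, IsOfFinAddOrder T ∧ X = (2 : ℤ) • S + T) →
      ∃ S T : M, IsOfFinAddOrder T ∧ (2 : ℤ) • R - X = (2 : ℤ) • S + T := by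
    rintro X ⟨S, T, hT, rfl⟩
    exact ⟨R - S, -T, hT.neg, by rw [smul_sub]; abel⟩
  have e₁ : R - c R = (2 : ℤ) • R - (R + c R) := by rw [two_smul]; abel
  have e₂ : R + c R = (2 : ℤ) • R - (R - c R) := by rw [two_smul]; abel
  exact ⟨fun h => e₁ ▸ key _ h, fun h => e₂ ▸ key _ h⟩

end Bookkeeping

/-! ## §2 THE TRANSFER at the binder level: `Y ∈ 2B(K) + tors` versus `R − cR ∈ 2B(L) + tors` -/

section Transfer

-- `K L : Type` (not universe-polymorphic): bsd-cm-two's `TraceRelationAtTwo` is stated over `Type`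
variable {K L : Type} [Field K] [CharZero K] [Field L] [CharZero L] [Algebra K L]
  (B : WeierstrassCurve ℚ)

/-- **(⟸) ANTI-TRACE `2`-DIVISIBLE MODULO TORSION ⟹ `Y ∈ 2B(K) + tors`.** `L/K` finite Galois of
characteristic `0`, `B(L)[2] = 0`, `θ` ANY additive map of `B(L)`, `N` odd, the trace relation
`N • ι Y = −θ(R + cR) + T` with `T` torsion (`TraceRelationAtTwo`), and `R − cR = 2•S + T′` with `T′`
torsion. Then `Y = 2•Y′ + T″` in `B(K)` (in fact `T″ = 0`): `R + cR = 2•(R − S) − T′`, so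
`N • ι Y − 2•(−θ(R − S)) = θ T′ + T` is torsion and x1b [162] `exists_eq_two_smul_of_smul_sub_torsion`
descends. bsd-cm-two's `exists_eq_two_smul_add_torsion_of_trace_of_antiTrace` (p503775) and x1b [162]
`exists_eq_two_smul_of_trace_of_antiTrace` are the case `S = 0`, `T′ = R − cR`.
[cite: SilvermanAEC2009, VIII.§1] -/
theorem exists_eq_two_smul_add_torsion_of_trace_of_antiTrace_twoDivisible [IsGalois K L]
    [FiniteDimensional K L]
    (hL2 : ∀ Q : (B.baseChange L).toAffine.Point, (2 : ℕ) • Q = 0 → Q = 0) (c : L ≃ₐ[K] L)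
    (θ : (B.baseChange L).toAffine.Point →+ (B.baseChange L).toAffine.Point) {N : ℤ} (hN : Odd N)
    {Y : (B.baseChange K).toAffine.Point} {R T : (B.baseChange L).toAffine.Point}
    (hT : IsOfFinAddOrder T) (htrace : TraceRelationAtTwo B K L c θ N Y R T)
    (hanti : ∃ S T' : (B.baseChange L).toAffine.Point, IsOfFinAddOrder T' ∧
      R - Affine.Point.map (W' := B) (c : L →ₐ[K] L) R = (2 : ℤ) • S + T') :
    ∃ Y' T'' : (B.baseChange K).toAffine.Point, IsOfFinAddOrder T'' ∧ Y = (2 : ℤ) • Y' + T'' := by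
  obtain ⟨S, T', hT', hS⟩ := hanti
  have key : IsOfFinAddOrder (N • Affine.Point.map (W' := B) (algebraMap K L).toRatAlgHom Y -
      (2 : ℤ) • (-(θ (R - S)))) := by
    have e : N • Affine.Point.map (W' := B) (algebraMap K L).toRatAlgHom Y - (2 : ℤ) • (-(θ (R - S))) =
        θ T' + T := by
      rw [map_toRatAlgHom_eq_baseChange, htrace]
      have e' : R + Affine.Point.map (W' := B) (c : L →ₐ[K] L) R = (2 : ℤ) • (R - S) - T' := by
        have : Affine.Point.map (W' := B) (c : L →ₐ[K] L) R = R - ((2 : ℤ) • S + T') := by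
          rw [← hS]; abel
        rw [this, two_smul, two_smul]; abel
      rw [e', map_sub, map_zsmul, smul_neg]
      abel
    rw [e]
    exact (θ.isOfFinAddOrder hT').add hT
  obtain ⟨Z', hZ'⟩ := exists_eq_two_smul_of_smul_sub_torsion B hL2 hN key
  exact ⟨Z', 0, IsOfFinAddOrder.zero, by rw [hZ', add_zero]⟩

/-- **(⟹) `Y ∈ 2B(K) + tors` ⟹ ANTI-TRACE `2`-DIVISIBLE MODULO TORSION**, for `θ` an additive
AUTOMORPHISM of `B(L)` (the CM unit `[ζ]`): from `Y = 2•Y′ + T″` and `N • ι Y = −θ(R + cR) + T` one gets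
`R + cR = 2•θ⁻¹(−N • ι Y′) + θ⁻¹(T − N • ι T″)`, and `R − cR = 2•R − (R + cR)` (§1). No hypothesis on `N`,
on `L/K` or on `2`-torsion is needed in this direction. MEMO-bsd-cm-two v2.11 §54.3. [folklore] -/
theorem antiTrace_twoDivisible_of_trace_of_eq_two_smul_add_torsion (c : L ≃ₐ[K] L)
    (θ : (B.baseChange L).toAffine.Point ≃+ (B.baseChange L).toAffine.Point) (N : ℤ)
    {Y : (B.baseChange K).toAffine.Point} {R T : (B.baseChange L).toAffine.Point}
    (hT : IsOfFinAddOrder T) (htrace : TraceRelationAtTwo B K L c (θ : _ →+ _) N Y R T)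
    (hY : ∃ Y' T'' : (B.baseChange K).toAffine.Point, IsOfFinAddOrder T'' ∧ Y = (2 : ℤ) • Y' + T'') :
    ∃ S T' : (B.baseChange L).toAffine.Point, IsOfFinAddOrder T' ∧
      R - Affine.Point.map (W' := B) (c : L →ₐ[K] L) R = (2 : ℤ) • S + T' := by
  set ι : (B.baseChange K).toAffine.Point →+ (B.baseChange L).toAffine.Point :=
    Affine.Point.baseChange (W' := B) K L with hι
  -- `θ (R + cR) = -(N • ι Y) + T` is `2`-divisible modulo torsion
  have h1 : ∃ S T' : (B.baseChange L).toAffine.Point, IsOfFinAddOrder T' ∧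
      (θ : _ →+ _) (R + Affine.Point.map (W' := B) (c : L →ₐ[K] L) R) = (2 : ℤ) • S + T' := by
    have e : (θ : _ →+ _) (R + Affine.Point.map (W' := B) (c : L →ₐ[K] L) R) = -(N • ι Y) + T := by
      have h := htrace
      unfold TraceRelationAtTwo at h
      rw [← hι] at h
      rw [h]; abel
    rw [e]
    refine (exists_eq_two_smul_add_torsion_add_iff hT _).mpr ?_
    refine (exists_eq_two_smul_add_torsion_neg_iff _).mpr ?_
    obtain ⟨Y', T'', hT'', rfl⟩ := hY
    exact ⟨N • ι Y', N • ι T'', (ι.isOfFinAddOrder hT'').zsmul, by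
      rw [map_add, map_zsmul, smul_add, smul_comm]⟩
  -- pull back along `θ`, then pass from `R + cR` to `R - cR`
  have h2 : ∃ S T' : (B.baseChange L).toAffine.Point, IsOfFinAddOrder T' ∧
      R + Affine.Point.map (W' := B) (c : L →ₐ[K] L) R = (2 : ℤ) • S + T' :=
    (exists_eq_two_smul_add_torsion_iff_of_addEquiv θ _).mp h1
  exact (exists_eq_two_smul_add_torsion_add_map_iff_sub_map
    (Affine.Point.map (W' := B) (c : L →ₐ[K] L)) R).mp h2

/-- **THE TRANSFER OF `2`-DIVISIBILITY (MEMO-bsd-cm-two v2.11 §54.3, kernel form).** `L/K` finite Galois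
of characteristic `0`, `B/ℚ` with `B(L)[2] = 0`, `c : L ≃ₐ[K] L`, `θ` an additive automorphism of `B(L)`,
`N` odd, `N • ι Y = −θ(R + cR) + T` with `T` torsion. THEN
«`Y ∈ 2B(K) + B(K)_tors`» ⟺ «the anti-trace `R − cR ∈ 2B(L) + B(L)_tors`».
For `p ≡ 7 (9)` the right side holds because `R − cR` is torsion (THEOREM C′); for `p ≡ 4 (9)` it is the
`2`-divisibility of (the image of) the sextic Heegner point `y_{χκ}` — the two residue classes share
the left-to-right algebra. ONE factor of `2` only (memo §54.4). [cite: SilvermanAEC2009, VIII.§1] -/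
theorem twoDivisible_iff_antiTrace_twoDivisible_of_traceRelation [IsGalois K L] [FiniteDimensional K L]
    (hL2 : ∀ Q : (B.baseChange L).toAffine.Point, (2 : ℕ) • Q = 0 → Q = 0) (c : L ≃ₐ[K] L)
    (θ : (B.baseChange L).toAffine.Point ≃+ (B.baseChange L).toAffine.Point) {N : ℤ} (hN : Odd N)
    {Y : (B.baseChange K).toAffine.Point} {R T : (B.baseChange L).toAffine.Point}
    (hT : IsOfFinAddOrder T) (htrace : TraceRelationAtTwo B K L c (θ : _ →+ _) N Y R T) :
    (∃ Y' T'' : (B.baseChange K).toAffine.Point, IsOfFinAddOrder T'' ∧ Y = (2 : ℤ) • Y' + T'') ↔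
      ∃ S T' : (B.baseChange L).toAffine.Point, IsOfFinAddOrder T' ∧
        R - Affine.Point.map (W' := B) (c : L →ₐ[K] L) R = (2 : ℤ) • S + T' :=
  ⟨antiTrace_twoDivisible_of_trace_of_eq_two_smul_add_torsion B c θ N hT htrace,
    exists_eq_two_smul_add_torsion_of_trace_of_antiTrace_twoDivisible B hL2 c (θ : _ →+ _) hN hT htrace⟩

/-- **THE PRIMITIVITY TRANSFER (contrapositive form; MEMO-bsd-cm-two v2.11 §54.3 «`Z_p` is a `2`-adic
generator of `E_p(K)` ⟺ `y_{χκ}` is a `2`-adic generator of `E_p^{(−1)}(K)`», algebraic half).** Same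
hypotheses: «`Y ∉ 2B(K) + tors`» ⟺ «`R − cR ∉ 2B(L) + tors`». [cite: SilvermanAEC2009, VIII.§1] -/
theorem twoPrimitive_iff_antiTrace_twoPrimitive_of_traceRelation [IsGalois K L] [FiniteDimensional K L]
    (hL2 : ∀ Q : (B.baseChange L).toAffine.Point, (2 : ℕ) • Q = 0 → Q = 0) (c : L ≃ₐ[K] L)
    (θ : (B.baseChange L).toAffine.Point ≃+ (B.baseChange L).toAffine.Point) {N : ℤ} (hN : Odd N)
    {Y : (B.baseChange K).toAffine.Point} {R T : (B.baseChange L).toAffine.Point}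
    (hT : IsOfFinAddOrder T) (htrace : TraceRelationAtTwo B K L c (θ : _ →+ _) N Y R T) :
    (¬ ∃ Y' T'' : (B.baseChange K).toAffine.Point, IsOfFinAddOrder T'' ∧ Y = (2 : ℤ) • Y' + T'') ↔
      ¬ ∃ S T' : (B.baseChange L).toAffine.Point, IsOfFinAddOrder T' ∧
        R - Affine.Point.map (W' := B) (c : L →ₐ[K] L) R = (2 : ℤ) • S + T' :=
  not_congr (twoDivisible_iff_antiTrace_twoDivisible_of_traceRelation B hL2 c θ hN hT htrace)

end Transfer

/-! ## §3 THE TWIST LAYER: `2`-divisibility of `σ`-anti-fixed points is read on the quadratic twist -/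

section Twist

open WeierstrassCurve.QuadraticDescent Literature.NumberTheory.QuadraticFields

universe u v

variable {F : Type u} {K : Type v} [Field F] [Field K] [Algebra F K] [NeZero (2 : F)]
  (W : WeierstrassCurve F) (h2 : Module.finrank F K = 2) {θ : K} {c : F}
  (hθ : θ ∉ Set.range (algebraMap F K)) (hc : θ ^ 2 = algebraMap F K c)

omit [NeZero (2 : F)] in
include h2 hθ hc in
/-- A non-trivial `F`-endomorphism `σ` of the quadratic extension `K = F(θ′)` acts on points as the
conjugation `Quadratic.conj` of the tree's twist dictionary (both are `a + bθ′ ↦ a − bθ′`,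
`Quadratic.apply_eq_conj_of_ne_id`). [folklore] -/
theorem conjMap_eq_conjMap_conj (V : WeierstrassCurve F) {σ : K →ₐ[F] K} (hσ : σ ≠ AlgHom.id F K)
    (P : (V.baseChange K).toAffine.Point) :
    conjMap V σ P = conjMap V (Quadratic.conj h2 hθ hc) P := by
  rcases P with _ | ⟨x, y, h⟩
  · rfl
  · simp only [Affine.Point.map_some, Quadratic.apply_eq_conj_of_ne_id h2 hθ hc hσ]

include h2 in
/-- **`τQ ∈ 2W¹(K) + tors` forces `Q ∈ 2W^{(c)}(F)`** when `W¹(K)[2] = 0` (`W¹ = W.quadraticTwist 1` the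
completed-square model, `τ = twistMap`, `K = F(θ′)`, `θ′² = c`). Proof: `T` has odd order `m`, so
`τ(m•Q) = 2•S₁` with `S₁ = m•S`; since `σ∘τ = −τ` (tree `conjMap_twistMap`) and there is no `2`-torsion,
`σS₁ = −S₁`, so `S₁ = τQ″` (tree `mem_range_twistMap_of_conjMap_eq_neg`); `τ` is injective, so
`m•Q = 2•Q″` with `m` odd, whence `Q = 2•Q′` (x1b [161]). Silverman AEC X.2 / Exercise 10.16.
[cite: SilvermanAEC2009, Exercise 10.16] -/
theorem exists_eq_two_smul_of_twistMap_eq_two_smul_add_torsion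
    (hK2 : ∀ P : ((W.quadraticTwist 1).baseChange K).toAffine.Point, (2 : ℕ) • P = 0 → P = 0)
    {Q : (W.quadraticTwist c).toAffine.Point} {S T : ((W.quadraticTwist 1).baseChange K).toAffine.Point}
    (hT : IsOfFinAddOrder T) (h : twistMap W hθ hc Q = (2 : ℤ) • S + T) :
    ∃ Q' : (W.quadraticTwist c).toAffine.Point, Q = (2 : ℤ) • Q' := by
  -- `T` has odd order `m`
  obtain ⟨k, hk⟩ := odd_addOrderOf_of_forall_two_nsmul_eq_zero hK2 hT
  set m : ℕ := addOrderOf T with hm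
  have hmT : (m : ℤ) • T = 0 := by rw [natCast_zsmul]; exact addOrderOf_nsmul_eq_zero T
  -- `τ (m • Q) = 2 • S₁`
  set S₁ : ((W.quadraticTwist 1).baseChange K).toAffine.Point := (m : ℤ) • S with hS₁
  have h1 : twistMap W hθ hc ((m : ℤ) • Q) = (2 : ℤ) • S₁ := by
    rw [map_zsmul, h, smul_add, hmT, add_zero, hS₁, smul_comm]
  -- `σ S₁ = -S₁`
  set σ := Quadratic.conj h2 hθ hc with hσdef
  have hσθ : σ θ = -θ := Quadratic.conj_gen h2 hθ hc
  have h2S : (2 : ℕ) • (conjMap (W.quadraticTwist 1) σ S₁ + S₁) = 0 := by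
    have e : conjMap (W.quadraticTwist 1) σ ((2 : ℤ) • S₁) = -((2 : ℤ) • S₁) := by
      rw [← h1, conjMap_twistMap W hθ hc hσθ]
    rw [map_zsmul, ← smul_neg, ← sub_eq_zero, ← smul_sub, sub_neg_eq_add] at e
    rw [← natCast_zsmul]
    exact_mod_cast e
  have hanti : conjMap (W.quadraticTwist 1) σ S₁ = -S₁ :=
    eq_neg_of_add_eq_zero_left (hK2 _ h2S)
  -- so `S₁ = τ Q″`
  obtain ⟨Q'', hQ''⟩ := AddMonoidHom.mem_range.mp
    (mem_range_twistMap_of_conjMap_eq_neg W h2 hθ hc S₁ hanti)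
  -- `m • Q = 2 • Q″` by injectivity of `τ`
  have h3 : (m : ℤ) • Q = (2 : ℤ) • Q'' := by
    apply twistMap_injective W hθ hc
    rw [h1, map_zsmul, hQ'']
  have hmodd : Odd (m : ℤ) := by rw [hk]; push_cast; exact odd_two_mul_add_one (k : ℤ)
  exact exists_eq_two_smul_of_odd_smul_eq_two_smul hmodd h3

include h2 in
/-- **`2`-DIVISIBILITY MODULO TORSION IS READ ON THE TWIST.** `K = F(θ′)`, `θ′² = c`, `2 ≠ 0`,
`W¹(K)[2] = 0`: for every `Q ∈ W^{(c)}(F)`, «`τQ ∈ 2W¹(K) + tors`» ⟺ «`Q ∈ 2W^{(c)}(F) + tors`»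
(`←`: `τ` is additive; `→`: the previous theorem). [cite: SilvermanAEC2009, Exercise 10.16] -/
theorem twoDivisible_twistMap_iff
    (hK2 : ∀ P : ((W.quadraticTwist 1).baseChange K).toAffine.Point, (2 : ℕ) • P = 0 → P = 0)
    (Q : (W.quadraticTwist c).toAffine.Point) :
    (∃ S T : ((W.quadraticTwist 1).baseChange K).toAffine.Point, IsOfFinAddOrder T ∧
        twistMap W hθ hc Q = (2 : ℤ) • S + T) ↔
      ∃ Q' T' : (W.quadraticTwist c).toAffine.Point, IsOfFinAddOrder T' ∧ Q = (2 : ℤ) • Q' + T' := by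
  refine ⟨fun ⟨S, T, hT, h⟩ => ?_, exists_eq_two_smul_add_torsion_map (twistMap W hθ hc)⟩
  obtain ⟨Q', hQ'⟩ := exists_eq_two_smul_of_twistMap_eq_two_smul_add_torsion W h2 hθ hc hK2 hT h
  exact ⟨Q', 0, IsOfFinAddOrder.zero, by rw [hQ', add_zero]⟩

include h2 hθ hc in
/-- **THE ANTI-TRACE LIVES ON THE TWIST.** For a non-trivial `F`-endomorphism `σ` of `K = F(θ′)` and any
`R ∈ W¹(K)`, the anti-trace `R − σR` is `τQ` for a (unique) `Q ∈ W^{(c)}(F)` (tree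
`sub_conjMap_mem_range_twistMap`, restated for an abstract `σ`). [cite: SilvermanAEC2009, Exercise 10.16] -/
theorem exists_twistMap_eq_sub_conjMap {σ : K →ₐ[F] K} (hσ : σ ≠ AlgHom.id F K)
    (R : ((W.quadraticTwist 1).baseChange K).toAffine.Point) :
    ∃ Q : (W.quadraticTwist c).toAffine.Point,
      twistMap W hθ hc Q = R - conjMap (W.quadraticTwist 1) σ R := by
  rw [conjMap_eq_conjMap_conj h2 hθ hc (W.quadraticTwist 1) hσ]
  exact AddMonoidHom.mem_range.mp (sub_conjMap_mem_range_twistMap W h2 hθ hc R)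

include h2 in
/-- **TRANSFER, TWIST LAYER.** `K = F(θ′)`, `θ′² = c`, `2 ≠ 0`, `W¹(K)[2] = 0`, `σ` an `F`-endomorphism of
`K`, `R ∈ W¹(K)` with anti-trace `R − σR = τQ`. THEN «`R − σR ∈ 2W¹(K) + tors`» ⟺
«`Q ∈ 2W^{(c)}(F) + tors`». With §2 (for `L = K(i)` over the CM field: `F ↝ K`, `K ↝ L`, `c ↝ −1`):
«`Y ∈ 2E(K) + tors` ⟺ the twist point of the anti-trace is in `2E^{(−1)}(K) + tors`» — the algebraic
half of MEMO-bsd-cm-two v2.11 §54.3. [cite: SilvermanAEC2009, Exercise 10.16] -/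
theorem twoDivisible_sub_conjMap_iff_of_twistMap_eq
    (hK2 : ∀ P : ((W.quadraticTwist 1).baseChange K).toAffine.Point, (2 : ℕ) • P = 0 → P = 0)
    (σ : K →ₐ[F] K) (R : ((W.quadraticTwist 1).baseChange K).toAffine.Point)
    {Q : (W.quadraticTwist c).toAffine.Point}
    (hQ : twistMap W hθ hc Q = R - conjMap (W.quadraticTwist 1) σ R) :
    (∃ S T : ((W.quadraticTwist 1).baseChange K).toAffine.Point, IsOfFinAddOrder T ∧
        R - conjMap (W.quadraticTwist 1) σ R = (2 : ℤ) • S + T) ↔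
      ∃ Q' T' : (W.quadraticTwist c).toAffine.Point, IsOfFinAddOrder T' ∧ Q = (2 : ℤ) • Q' + T' := by
  rw [← hQ]
  exact twoDivisible_twistMap_iff W h2 hθ hc hK2 Q

end Twist

end Summit.BirchSwinnertonDyer.BirchSwinnertonDyer.Theorems.SylvesterTwoYinToricTransfer

end
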